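import Literature.MathematicalPhysics.QuantumFieldTheory.Balaban1983to89.Node00.Record13
import Literature.MathematicalPhysics.QuantumFieldTheory.Balaban1983to89.Node00.Record12NumericsFamilyDict
import Literature.MathematicalPhysics.QuantumFieldTheory.Balaban1983to89.Node00.Record12LiveSelectorInt
import Literature.MathematicalPhysics.QuantumFieldTheory.Balaban1983to89.Node00.Record12MeasurabilityAbsolute

/-!
# NODE 00 (YM-PLAN Track A) — STAGE 13: THE LIVE RE-PIN `liveRepin₁₃` ALONG THE ₁₃ HISTORIES, ROW P12 AT IT (five-line instance of the history-generic
# `Record12LiveSelectorInt`), AND THE RE-PINNED WITNESS `θ₁₃ = theta13LiveOfFamily F N ε₀ ζ Rz Zt` WITH ITS FACES (gate rows G ∕ P12∕S ∕ Z)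

Cell `pub-ymgap`, seat `pub-ymgap-node00-def-K0a` (g3).  [III] = [Balaban1988Convergent], [IV] = [Balaban1989LargeFieldI].

ALSO (keyed to `Record13` v1.1: `Provisos₁₃.bg` over the RANGED token `BgProvisoΛ`, director-ym LINE №131∕№132): `Stage13Params.bg_liveRepin₁₃_iff`,
`Stage13Params.provisos₁₃_liveRepin₁₃_of_localBg` (`Provisos₁₃` at the ₁₃ live re-pin ⟸ (H-U) ∧ row P11, by `Record13` §4c + K0b's ζ-laws) and, at the witness of
record, `provisos₁₃_theta13LiveOfRecord_of_bg` ∕ ★★★ `exists_k0_of_bg_theta13LiveOfRecord`: THE K0″ BODY FOR `F` ⟸ ROW P11 ALONE ((H-U) is K0c's theorem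
`localBgMeasurable`, `Node00/Record12MeasurabilityAbsolute`; P11 is seat node00-def-P11's analysis on the ranged token `BgProvisoΛ`).

HONEST FRAMING.  Definitions of a re-pinned parameter + `rfl` views + instantiation by name; `Provisos₁₃` at the witness is a HYPOTHESIS (the open rows); nothing
of Bałaban asserted; NOT a discharge; counts unmoved; one finite 𝕋⁴ programme at fixed ε — NOT continuum ∕ OS ∕ mass gap ∕ Clay.  No `sorry`, `axiom`,
`instance`, `notation`.  v1.4 = v1.2 byte-identical (v1.3's forward-compatible `bg` transition proof WITHDRAWN: director-ym №138 — gate5 refuses in-place body changes; the guarded proviso is ADDED under a new name, so the `bg` field of `Provisos₁₃` never changes and the transition alternatives were dead lint debt).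
-/

noncomputable section

open MeasureTheory
open scoped BigOperators Matrix.Norms.L2Operator

namespace Literature.MathematicalPhysics.QuantumFieldTheory.Balaban1983to89.Node00

open T4Continuum B14.Eq218Concrete B15RopTotal FlowStep FlowStepRuns

/-! ## §1. The live re-pin of a Stage-12 parameter ALONG THE ₁₃ HISTORIES -/

section Repin13

variable (F : T4Family) (N : ℕ) [NeZero N]

/-- **THE LIVE RE-PIN, STAGE 13** of `θ : Stage13Params`: the same parameter with its `p–p′` selector replaced by the live selector of record at `θ`'s own numerics,
the ₁₃ normalisations `EOfRecord₁₃` and the step weights `wOfRecord₉` (both selector-blind). [cite: Balaban1989LargeFieldI, (0.3) p.176 and p.177; Balaban1988Convergent, (3.22) p.269] -/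
def Stage13Params.liveRepin₁₃ (θ : Stage13Params F N) : Stage13Params F N :=
  { θ with ppSel := ppSelLiveOfRecord F N θ.ν θ.τ9 (EOfRecord₁₃ F N θ) (wOfRecord₉ F N θ.toStage9Params) }

variable (θ : Stage13Params F N)

/-- The re-pin keeps the Stage-8 part (`rfl`). [cite: Balaban1987RG1, (0.21) p.256 (bookkeeping)] -/
theorem Stage13Params.liveRepin₁₃_toStage8Params : (θ.liveRepin₁₃ F N).toStage8Params = θ.toStage8Params := rfl

/-- The re-pin's selector IS the live selector of record along the ₁₃ plugs (`rfl`). [cite: Balaban1989LargeFieldI, (0.3) p.176 (bookkeeping)] -/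
theorem Stage13Params.liveRepin₁₃_ppSel :
    (θ.liveRepin₁₃ F N).ppSel = ppSelLiveOfRecord F N θ.ν θ.τ9 (EOfRecord₁₃ F N θ) (wOfRecord₉ F N θ.toStage9Params) := rfl

/-- The re-pin keeps `ζ` (`rfl`). [cite: Balaban1988Convergent, (3.16) p.268 (bookkeeping)] -/
theorem Stage13Params.liveRepin₁₃_ζ : (θ.liveRepin₁₃ F N).ζ = θ.ζ := rfl

/-- The re-pin keeps `Rz` (`rfl`). [cite: Balaban1988Convergent, (2.21) p.258 (bookkeeping)] -/
theorem Stage13Params.liveRepin₁₃_Rz : (θ.liveRepin₁₃ F N).Rz = θ.Rz := rfl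

/-- The re-pin keeps `Zt` (`rfl`). [cite: Balaban1988Convergent, (3.20) p.269 (bookkeeping)] -/
theorem Stage13Params.liveRepin₁₃_Zt : (θ.liveRepin₁₃ F N).Zt = θ.Zt := rfl

/-- The re-pin keeps `A₁` (`rfl`). [cite: Balaban1987RG1, (1.16) p.262 (bookkeeping)] -/
theorem Stage13Params.liveRepin₁₃_A₁ : (θ.liveRepin₁₃ F N).A₁ = θ.A₁ := rfl

/-- The ₁₃ histories are selector-blind: the re-pin keeps them (`rfl`). [cite: Balaban1987RG1, (0.17)–(0.20) pp.255–256 (bookkeeping)] -/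
theorem Stage13Params.gOfRecord₁₃_liveRepin₁₃ :
    gOfRecord₁₃ F N (θ.liveRepin₁₃ F N) = gOfRecord₁₃ F N θ := rfl

/-- The ₁₃ normalisations are selector-blind (`rfl`). [cite: Balaban1988Convergent, (1.15) p.249 (bookkeeping)] -/
theorem Stage13Params.EOfRecord₁₃_liveRepin₁₃ :
    EOfRecord₁₃ F N (θ.liveRepin₁₃ F N) = EOfRecord₁₃ F N θ := rfl

/-- The step weights are selector-blind (`rfl`). [cite: Balaban1988Convergent, (3.2)–(3.9) pp.265–266 (bookkeeping)] -/
theorem Stage13Params.wOfRecord₉_liveRepin₁₃ :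
    wOfRecord₉ F N (θ.liveRepin₁₃ F N).toStage9Params = wOfRecord₉ F N θ.toStage9Params := rfl

variable {F N θ}

/-- `Admissible` is selector-blind: it transports to the ₁₃ re-pin. [cite: Balaban1987RG1, (0.21) p.256 (bookkeeping)] -/
theorem Stage13Params.Admissible.liveRepin₁₃ (h : θ.Admissible F N) : (θ.liveRepin₁₃ F N).Admissible F N := h

/-- `ZtUnity` is selector-blind. [cite: Balaban1988Convergent, (3.16)–(3.20) pp.268–269 (bookkeeping)] -/
theorem Stage13Params.ZtUnity.liveRepin₁₃ (h : θ.ZtUnity F N) : (θ.liveRepin₁₃ F N).ZtUnity F N := h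

/-- K0b's `HasResidualsOfRecord` is selector-blind. [cite: Balaban1988Convergent, (3.16) p.268, (2.21) p.258, (3.20) p.269 (bookkeeping)] -/
theorem Stage13Params.HasResidualsOfRecord.liveRepin₁₃ (h : θ.HasResidualsOfRecord F N) : (θ.liveRepin₁₃ F N).HasResidualsOfRecord F N :=
  ⟨h.zeta_eq, h.Rz_eq, h.Zt_eq⟩

variable (F N θ)

/-- **`SlotsNondegenerate₁₃` AT THE ₁₃ LIVE RE-PIN ⟺ PER-LEVEL LIVENESS UP TO THE TORUS** along the ₁₃ histories (as `slotsNondegenerate_liveRepin_iff` at ₁₂).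
[cite: Balaban1988Convergent, (3.22)–(3.24) pp.269–270; Balaban1989LargeFieldI, (0.3) p.176] -/
theorem Stage13Params.slotsNondegenerate₁₃_liveRepin_iff :
    (θ.liveRepin₁₃ F N).SlotsNondegenerate₁₃ F N ↔
      ∀ (p : B12.RunParams) (k : ℕ), k + 1 ≤ p.K → Nonempty (SeqOfRecord F θ.ν θ.τ9.M (gOfRecord₁₃ F N θ p) p.K (k + 1)) →
        ∃ s, LiveSeq F N θ.ν θ.τ9 p (gOfRecord₁₃ F N θ p) (k + 1)
          (slotsTOfRecord F N θ.ν θ.τ9 (EOfRecord₁₃ F N θ) (wOfRecord₉ F N θ.toStage9Params) (θ.liveRepin₁₃ F N).ppSel p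
            (gOfRecord₁₃ F N θ p) (k + 1)) s := by
  constructor
  · intro h p k hk
    refine (slotsOfRecord_ppSelLive_succ_nondegenerate_iff F N θ.ν θ.τ9 _ _ p _ k).mp (fun s hs => ?_)
    have h' := h p (k + 1)
    apply h' <;> first | exact hk | exact hs
  · intro h p k s
    intros
    cases k with
    | zero => exact slotsOfRecord_zero_ne_zero F N θ.ν θ.τ9 _ _ _ p _ s
    | succ k =>
      refine (slotsOfRecord_ppSelLive_succ_nondegenerate_iff F N θ.ν θ.τ9 _ _ p _ k).mpr (h p k ‹_›) s ?_
      assumption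

/-- **★ `SlotsNondegenerate₁₃` AT THE ₁₃ LIVE RE-PIN, INT currency** — the five-line instance of the history-generic `slotsOfRecord_ppSelLive_ne_zero_of_le_of_int`
(`Record12LiveSelectorInt` §2) at `(E, w, g) := (EOfRecord₁₃ θ′, wOfRecord₉ θ′, gOfRecord₁₃ θ′ p)`: from the displayed step provisos (levels `j < K`) and Int-form
R-step provisos (levels `j + 1 ≤ K`) READ AT THE ₁₃ LIVE SELECTOR. [cite: Balaban1988Convergent, (3.22) p.269, (3.24) p.270; Balaban1989LargeFieldI, (0.3)–(0.4) p.176] -/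
theorem Stage13Params.slotsNondegenerate₁₃_liveRepin_of_int
    (hT : ∀ (p : B12.RunParams) (j : ℕ), j < p.K →
      TStepProvisos F N θ.ν θ.τ9 (EOfRecord₁₃ F N θ) (wOfRecord₉ F N θ.toStage9Params) (θ.liveRepin₁₃ F N).ppSel p
        (gOfRecord₁₃ F N θ p) j)
    (hR : ∀ (p : B12.RunParams) (j : ℕ) [DecidableEq (PBond (F.P p.K) (j + 1))], j < p.K →
      (towerRepOfRecord F N θ.ν θ.τ9
        (slotsTOfRecord F N θ.ν θ.τ9 (EOfRecord₁₃ F N θ) (wOfRecord₉ F N θ.toStage9Params) (θ.liveRepin₁₃ F N).ppSel)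
        (θ.liveRepin₁₃ F N).ppSel p (gOfRecord₁₃ F N θ p) (j + 1)).toRepData.ProvisosInt) :
    (θ.liveRepin₁₃ F N).SlotsNondegenerate₁₃ F N :=
  fun p k s hk hs => slotsOfRecord_ppSelLive_ne_zero_of_le_of_int F N θ.ν θ.τ9 _ _ p _ (hT p) (fun j _ hj => hR p j hj) k hk s hs

/-- **★ `SlotsNondegenerate₁₃` AT THE ₁₃ LIVE RE-PIN from `Provisos₁₃` there ALONE** (its `tstep` and `rstep` fields feed the Int instance; row P12 at the ₁₃
witness costs nothing beyond the displayed provisos). [cite: Balaban1988Convergent, (3.22) p.269, (3.24) p.270; Balaban1989LargeFieldI, (0.3)–(0.4) p.176] -/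
theorem Stage13Params.slotsNondegenerate₁₃_liveRepin (h : (θ.liveRepin₁₃ F N).Provisos₁₃ F N) : (θ.liveRepin₁₃ F N).SlotsNondegenerate₁₃ F N :=
  Stage13Params.slotsNondegenerate₁₃_liveRepin_of_int F N θ (fun p j hj => h.tstep p j hj) (fun p j _ hj => h.rstep p j hj)

/-- The row-P11 run objects are selector-blind: the §2 setting at the ₁₃ re-pin IS `θ`'s (`rfl`). [cite: Balaban1988Convergent, (2.28) p.259 (bookkeeping)] -/
theorem Stage13Params.settingOfRecord₁₃_liveRepin₁₃ (p : B12.RunParams) :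
    settingOfRecord₁₃ F N (θ.liveRepin₁₃ F N) p = settingOfRecord₁₃ F N θ p := rfl

/-- … the support of record at the ₁₃ re-pin IS `θ`'s (`rfl`). [cite: Balaban1988Convergent, (2.10) p.256 (bookkeeping)] -/
theorem Stage13Params.suppOfRecord₁₃_liveRepin₁₃ (p : B12.RunParams) (n : ℕ) :
    suppOfRecord₁₃ F N (θ.liveRepin₁₃ F N) p n = suppOfRecord₁₃ F N θ p n := rfl

/-- … and the background maps of record at the ₁₃ re-pin ARE `θ`'s (by cases on the length). [cite: Balaban1988Convergent, (2.12)–(2.13) pp.256–257 (bookkeeping)] -/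
theorem Stage13Params.UbgOfRecord₁₃_liveRepin₁₃ (p : B12.RunParams) (n : ℕ) :
    UbgOfRecord₁₃ F N (θ.liveRepin₁₃ F N) p n = UbgOfRecord₁₃ F N θ p n := by
  cases n <;> rfl

/-- **ROW P11 IS SELECTOR-BLIND**: the `bg` text at the ₁₃ re-pin ⟺ the `bg` text at `θ` (same window, histories, residual, support; background maps by
`UbgOfRecord₁₃_liveRepin₁₃`) — the P11 pen may state its row at either parameter. [cite: Balaban1988Convergent, (2.28) p.259 (bookkeeping)] -/
theorem Stage13Params.bg_liveRepin₁₃_iff :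
    (∀ (p : B12.RunParams) (n : ℕ), n ≤ p.K → Step.InInterval θ.γ n (gOfRecord₁₃ F N θ p) →
      BgProvisoΛ F N p.K (settingOfRecord₁₃ F N (θ.liveRepin₁₃ F N) p) (θ.Rz p.K) θ.τ9.M n (suppOfRecord₁₃ F N (θ.liveRepin₁₃ F N) p n)
        (UbgOfRecord₁₃ F N (θ.liveRepin₁₃ F N) p n)) ↔
    (∀ (p : B12.RunParams) (n : ℕ), n ≤ p.K → Step.InInterval θ.γ n (gOfRecord₁₃ F N θ p) →
      BgProvisoΛ F N p.K (settingOfRecord₁₃ F N θ p) (θ.Rz p.K) θ.τ9.M n (suppOfRecord₁₃ F N θ p n) (UbgOfRecord₁₃ F N θ p n)) := by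
  refine forall_congr' fun p => forall_congr' fun n => ?_
  rw [θ.UbgOfRecord₁₃_liveRepin₁₃ F N p n]
  rfl

variable {F N θ} in
/-- **★ `Provisos₁₃` AT THE ₁₃ LIVE RE-PIN OF A PARAMETER CARRYING K0b's RESIDUALS, FROM (H-U) AND ROW P11 ALONE**: rows `intPiece` ∕ `measω` ∕ `measChi` ∕
`rstep` (Int form, at the live selector: `hsel` is `rfl`) are `Record13` §4c's theorems of the measurability hypothesis (H-U) `LocalBgMeasurable θ.ν` and the
ζ-laws of K0b's (3.16) factor (`zetaMeasurable_zeta316OfRecord_of_localBg`, `HasResidualsOfRecord.zetaAbs`, `zeta316OfRecord_nonneg`); `zetaUnity`, `rzLaws`,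
`ztLaws`, `ztLocal` are K0b's; `bg` is DISPLAYED (row P11, seat node00-def-P11).  A REDUCTION — nothing of Bałaban is asserted.
[cite: Balaban1988Convergent, (2.18) p.257, (2.28) p.259, (3.2)–(3.9) pp.265–266, (3.16) p.268, (3.20)–(3.22) p.269; Balaban1989LargeFieldI, (0.3)–(0.4) p.176 (bookkeeping)] -/
theorem Stage13Params.provisos₁₃_liveRepin₁₃_of_localBg (hU : LocalBgMeasurable F N θ.ν) (hres : θ.HasResidualsOfRecord F N)
    (hbg : ∀ (p : B12.RunParams) (n : ℕ), n ≤ p.K → Step.InInterval θ.γ n (gOfRecord₁₃ F N θ p) →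
      BgProvisoΛ F N p.K (settingOfRecord₁₃ F N (θ.liveRepin₁₃ F N) p) (θ.Rz p.K) θ.τ9.M n (suppOfRecord₁₃ F N (θ.liveRepin₁₃ F N) p n)
        (UbgOfRecord₁₃ F N (θ.liveRepin₁₃ F N) p n)) :
    (θ.liveRepin₁₃ F N).Provisos₁₃ F N :=
  have hζ : ZetaMeasurable F N θ.ζ := by
    rw [hres.zeta_eq]; exact zetaMeasurable_zeta316OfRecord_of_localBg hU θ.τ9.M θ.A₁
  have hζ0 : ∀ p g k s Pl Ql RS U V', 0 ≤ θ.ζ p g k s Pl Ql RS U V' := by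
    rw [hres.zeta_eq]; exact fun p g k s Pl Ql RS U V' => zeta316OfRecord_nonneg θ.A₁ p g k s Pl Ql RS U V'
  { intPiece := (θ.liveRepin₁₃ F N).intPiece₁₃_of_localBg hU hζ hres.zetaAbs hζ0
    measω := (θ.liveRepin₁₃ F N).measω₁₃_of_localBg hU hζ
    measChi := (θ.liveRepin₁₃ F N).measChi₁₃_of_localBg hU
    zetaUnity := hres.zetaUnity
    zetaAbs := hres.zetaAbs
    rstep := (θ.liveRepin₁₃ F N).rstep₁₃_of_localBg_liveSel rfl hU hζ hres.zetaAbs hζ0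
    rzLaws := hres.rzLaws
    ztLaws := hres.ztLaws
    ztLocal := hres.ztLocal
    bg := hbg }

variable {F N θ} in
/-- **★★ `Provisos₁₃` AT THE ₁₃ LIVE RE-PIN OF A PARAMETER CARRYING K0b's RESIDUALS, FROM ROW P11 ALONE** — (H-U) is seat K0c's THEOREM `localBgMeasurable`
(`Node00/Record12MeasurabilityAbsolute`, over def-R's measurable-selection body of `UminOfRecord`, director-ym LINE №128 D1 (B)); every other field is §4c of
`Record13` + K0b's laws.  `bg` DISPLAYED (seat node00-def-P11's analysis on the ranged token). [cite: Balaban1988Convergent, (2.12) p.256, (2.18) p.257, (2.28) p.259, (3.16) p.268, (3.22) p.269; Balaban1989LargeFieldI, (0.3)–(0.4) p.176 (bookkeeping)] -/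
theorem Stage13Params.provisos₁₃_liveRepin₁₃_of_bg (hres : θ.HasResidualsOfRecord F N)
    (hbg : ∀ (p : B12.RunParams) (n : ℕ), n ≤ p.K → Step.InInterval θ.γ n (gOfRecord₁₃ F N θ p) →
      BgProvisoΛ F N p.K (settingOfRecord₁₃ F N (θ.liveRepin₁₃ F N) p) (θ.Rz p.K) θ.τ9.M n (suppOfRecord₁₃ F N (θ.liveRepin₁₃ F N) p n)
        (UbgOfRecord₁₃ F N (θ.liveRepin₁₃ F N) p n)) :
    (θ.liveRepin₁₃ F N).Provisos₁₃ F N :=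
  θ.provisos₁₃_liveRepin₁₃_of_localBg (localBgMeasurable F N θ.ν) hres hbg

end Repin13

/-! ## §1b. The (2.9) fluctuation threshold OF THE FAMILY `ε₁ := ε₀ ∕ 8` — the letter `Stage13Params.ε₂₉` carries (def-T CONSUMER-AUDIT ask) -/

section Eps1

/-- **THE (2.9) FLUCTUATION THRESHOLD OF THE FAMILY** at small-field threshold `ε₀`: `ε₁ := ε₀ ∕ 8` (print: the small-field condition `|V(b) V̄(b)⁻¹ − 1| < ε₁` of
[I] (2.9); the C4 species `chiFixed29 ν ε₁` of seat K0e's `SmallFieldChi29OfRecord`).  Chosen so that the hierarchy ordering `δ + 4ε₁ ≤ ε₀` holds for every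
Prop-2 smallness `δ ≤ ε₀ ∕ 2`; ARGUMENT-keyed like `ε₀` itself (row N2). [cite: Balaban1987RG1, (2.9) p.266 and (1.2) p.260; Balaban1988Convergent, p.265 (bookkeeping witness)] -/
def eps29OfFamily (ε₀ : ℝ) : ℝ :=
  ε₀ / 8

/-- The threshold of the family unfolds to `ε₀ ∕ 8` (`rfl`). [cite: Balaban1987RG1, (2.9) p.266 (bookkeeping)] -/
theorem eps29OfFamily_eq (ε₀ : ℝ) : eps29OfFamily ε₀ = ε₀ / 8 := rfl

/-- `0 < ε₁` at every positive `ε₀` (the sign `Stage13Params.Admissible` reads). [cite: Balaban1987RG1, (2.9) p.266 (bookkeeping)] -/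
theorem eps29OfFamily_pos {ε₀ : ℝ} (hε : 0 < ε₀) : 0 < eps29OfFamily ε₀ := by
  unfold eps29OfFamily
  positivity

/-- **`4ε₁ < ε₀`** at every positive `ε₀` (def-T's asked ordering). [cite: Balaban1987RG1, (2.9) p.266; Balaban1988Convergent, p.265 (bookkeeping numeral)] -/
theorem four_mul_eps29OfFamily_lt {ε₀ : ℝ} (hε : 0 < ε₀) : 4 * eps29OfFamily ε₀ < ε₀ := by
  unfold eps29OfFamily
  linarith

/-- **THE HIERARCHY ORDERING** (hypothesis `hord` of K0e's `mem_domAltOfRecord_of_chiFix29All_eq_one`): every Prop-2 smallness `δ ≤ ε₀ ∕ 2` of the critical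
configuration gives `δ + 4ε₁ ≤ ε₀` at the threshold of the family. [cite: Balaban1988Convergent, p.265; Balaban1989LargeFieldI, Prop. 1 (1.78) p.194 (bookkeeping numeral)] -/
theorem delta_add_four_mul_eps29OfFamily_le {ε₀ δ : ℝ} (hδ : δ ≤ ε₀ / 2) : δ + 4 * eps29OfFamily ε₀ ≤ ε₀ := by
  unfold eps29OfFamily
  linarith

end Eps1

/-! ## §2. The re-pinned witness `θ₁₃ = theta13LiveOfFamily F N ε₀ ζ Rz Zt` and its faces (gate rows G ∕ Z ∕ P12∕S ∕ N1) -/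

section Theta13

variable (F : T4Family) (N : ℕ) [NeZero N] (ε₀ : ℝ)
variable (ζ : ZetaOfRecord F N (numerics7OfFamily ε₀) 1) (Rz : (K : ℕ) → Sect2.Residual (F.P K) (MatA N)) (Zt : (K : ℕ) → TkResidualW F N (FluctV N) K)

/-- **THE STAGE-13 PARAMETER OF THE FAMILY (identity selector)** `θ₀ᶠᵃᵐ,¹³(ε₀)`: `theta12OfFamilyL F N ε₀ ζ Rz Zt` (block size `F.L`; κ := 2·10⁴; `ε₀` the open letter) extended by the (2.9)
fluctuation threshold `ε₁ := eps29OfFamily ε₀ = ε₀ ∕ 8`. [cite: Balaban1987RG1, (2.9) p.266; Balaban1988Convergent, (2.10) p.256 (bookkeeping witness)] -/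
def theta13OfFamily : Stage13Params F N :=
  { theta12OfFamilyL F N ε₀ ζ Rz Zt with ε₂₉ := eps29OfFamily ε₀ }

/-- `θ₀ᶠᵃᵐ,¹³(ε₀)`'s Stage-12 part IS `θ₀ᶠᵃᵐ(ε₀)` (`rfl`). [cite: Balaban1988Convergent, (2.10) p.256 (bookkeeping)] -/
theorem theta13OfFamily_toStage12Params : (theta13OfFamily F N ε₀ ζ Rz Zt).toStage12Params = theta12OfFamilyL F N ε₀ ζ Rz Zt := rfl

/-- `θ₀ᶠᵃᵐ,¹³(ε₀).ε₂₉ = ε₀ ∕ 8` (`rfl`). [cite: Balaban1987RG1, (2.9) p.266 (bookkeeping)] -/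
theorem theta13OfFamily_ε₂₉ : (theta13OfFamily F N ε₀ ζ Rz Zt).ε₂₉ = eps29OfFamily ε₀ := rfl

variable {ε₀} in
/-- **`θ₀ᶠᵃᵐ,¹³(ε₀)` IS STAGE-13 ADMISSIBLE at every positive threshold** (`Stage13Params.Admissible = toStage12Params.Admissible ∧ 0 < ε₂₉`).
[cite: Balaban1987RG1, (0.21) p.256, (2.9) p.266; Balaban1988Convergent, (2.10) p.256 (bookkeeping witness)] -/
theorem admissible_theta13OfFamily (hε : 0 < ε₀) : (theta13OfFamily F N ε₀ ζ Rz Zt).Admissible F N :=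
  ⟨admissible_theta12OfFamilyL F N ζ Rz Zt hε, eps29OfFamily_pos hε⟩

/-- `θ₀ᶠᵃᵐ,¹³(ε₀)` carries K0b's residuals of record (`⟨rfl, rfl, rfl⟩`). [cite: Balaban1988Convergent, (3.16) p.268, (2.21) p.258, (3.20) p.269 (bookkeeping)] -/
theorem hasResidualsOfRecord_theta13OfFamily :
    (theta13OfFamily F N ε₀ (zeta316OfRecord F N (numerics7OfFamily ε₀) 1 1) (RzOfRecord F N) (ZtOfRecord F N)).HasResidualsOfRecord F N :=
  ⟨rfl, rfl, rfl⟩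

/-- **THE STAGE-13 WITNESS OF THE FAMILY** `θ₁₃ := θ₀ᶠᵃᵐ,¹³(ε₀).liveRepin₁₃`: the `p–p′` selector re-pinned to the live selector of record ALONG THE ₁₃ HISTORIES.
[cite: Balaban1989LargeFieldI, (0.3) p.176 and p.177; Balaban1988Convergent, (3.22) p.269 (bookkeeping witness)] -/
def theta13LiveOfFamily : Stage13Params F N :=
  (theta13OfFamily F N ε₀ ζ Rz Zt).liveRepin₁₃ F N

/-- `θ₁₃` IS the ₁₃ live re-pin of `θ₀ᶠᵃᵐ,¹³(ε₀)` (`rfl`). [cite: Balaban1989LargeFieldI, (0.3) p.176 (bookkeeping)] -/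
theorem theta13LiveOfFamily_eq : theta13LiveOfFamily F N ε₀ ζ Rz Zt = (theta13OfFamily F N ε₀ ζ Rz Zt).liveRepin₁₃ F N := rfl

/-- `θ₁₃.ε₂₉ = ε₀ ∕ 8` (`rfl`). [cite: Balaban1987RG1, (2.9) p.266 (bookkeeping)] -/
theorem theta13LiveOfFamily_ε₂₉ : (theta13LiveOfFamily F N ε₀ ζ Rz Zt).ε₂₉ = eps29OfFamily ε₀ := rfl

/-- `θ₁₃.ν = numerics7OfFamily ε₀` (`rfl`). [cite: Balaban1988Convergent, (2.4) p.255 (bookkeeping)] -/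
theorem theta13LiveOfFamily_ν : (theta13LiveOfFamily F N ε₀ ζ Rz Zt).ν = numerics7OfFamily ε₀ := rfl

/-- `θ₁₃.γ = 1∕2` (`rfl`). [cite: Balaban1987RG1, Thm 1 p.255 (bookkeeping)] -/
theorem theta13LiveOfFamily_γ : (theta13LiveOfFamily F N ε₀ ζ Rz Zt).γ = 1 / 2 := rfl

/-- `θ₁₃.A₁ = 1` (`rfl`). [cite: Balaban1987RG1, (1.16) p.262 (bookkeeping)] -/
theorem theta13LiveOfFamily_A₁ : (theta13LiveOfFamily F N ε₀ ζ Rz Zt).A₁ = 1 := rfl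

/-- `θ₁₃.ℓ₆ + 1 = F.L` — the witness has THE FAMILY'S BLOCK SIZE. [cite: Balaban1987RG1, (0.1) p.251 (bookkeeping)] -/
theorem theta13LiveOfFamily_ℓ₆_succ : (theta13LiveOfFamily F N ε₀ ζ Rz Zt).ℓ₆ + 1 = F.L := stage3OfFamily_ℓ₆_succ F

/-- **★ N10's Lemma-3 level-T binder at `θ₁₃`**: `8 ≤ θ₁₃.ℓ₆ + 1`. [cite: Balaban1987RG1, (0.1) p.251; Balaban1988RG2Cluster, (2.36) p.19] -/
theorem eight_le_L_theta13LiveOfFamily : 8 ≤ (theta13LiveOfFamily F N ε₀ ζ Rz Zt).ℓ₆ + 1 := eight_le_L_stage3OfFamily F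

/-- `θ₁₃.s2.lf.κ = 2·10⁴` (`rfl`). [cite: Balaban1987RG1, (1.18) p.263 (bookkeeping)] -/
theorem theta13LiveOfFamily_κ : (theta13LiveOfFamily F N ε₀ ζ Rz Zt).s2.lf.κ = 20000 := rfl

/-- `θ₁₃`'s selector IS the live selector of record along the ₁₃ plugs (`rfl`). [cite: Balaban1989LargeFieldI, (0.3) p.176 (bookkeeping)] -/
theorem theta13LiveOfFamily_ppSel :
    (theta13LiveOfFamily F N ε₀ ζ Rz Zt).ppSel =
      ppSelLiveOfRecord F N (numerics7OfFamily ε₀) towerNumericsOfRecord₁₂ (EOfRecord₁₃ F N (theta13OfFamily F N ε₀ ζ Rz Zt))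
        (wOfRecord₉ F N (theta12OfFamilyL F N ε₀ ζ Rz Zt).toStage9Params) := rfl

variable {ε₀} in
/-- **`θ₁₃` IS ADMISSIBLE at every positive threshold** (row G). [cite: Balaban1987RG1, (0.21) p.256, (1.12) p.262, (1.20)–(1.21) p.264; Balaban1988Convergent, (2.10) p.256, (2.34)–(2.39) p.261, (3.4) p.265 (bookkeeping witness)] -/
theorem admissible_theta13LiveOfFamily (hε : 0 < ε₀) : (theta13LiveOfFamily F N ε₀ ζ Rz Zt).Admissible F N :=
  (admissible_theta13OfFamily F N ζ Rz Zt hε).liveRepin₁₃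

/-- Row N1 at `θ₁₃`: the (D4) `tree` numeral. [cite: Balaban1987RG1, (0.25)–(0.26) p.257] -/
theorem kp_tree_theta13LiveOfFamily : 128 * Real.log 162 ≤ (theta13LiveOfFamily F N ε₀ ζ Rz Zt).s2.lf.κ := kp_tree_lfConstsOfFamily

/-- Row N1 at `θ₁₃`: the (D4) `large` numeral. [cite: Balaban1987RG1, (0.25)–(0.26) p.257; Balaban1988RG2Cluster, p.21 (after (2.39))] -/
theorem kp_large_theta13LiveOfFamily :
    10 * (64 * Real.log 162 + 1) ≤
      (((((theta13LiveOfFamily F N ε₀ ζ Rz Zt).ℓ₆ + 1 : ℕ) : ℝ)) / 2 - 1) * (theta13LiveOfFamily F N ε₀ ζ Rz Zt).s2.lf.κ :=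
  kp_large_theta12OfFamilyL F N ε₀ ζ Rz Zt

/-- Row N1 at `θ₁₃`: N10's rate threshold. [cite: Balaban1987RG1, (1.18) p.263 (bookkeeping numeral)] -/
theorem kp_n10_theta13LiveOfFamily : (2 * 10 ^ 4 : ℝ) ≤ (theta13LiveOfFamily F N ε₀ ζ Rz Zt).s2.lf.κ := kp_n10_lfConstsOfFamily

/-- **AT K0b's RESIDUALS OF RECORD `θ₁₃` CARRIES THEM** (`⟨rfl, rfl, rfl⟩`). [cite: Balaban1988Convergent, (3.16) p.268, (2.21) p.258, (3.20) p.269 (bookkeeping)] -/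
theorem hasResidualsOfRecord_theta13LiveOfFamily :
    (theta13LiveOfFamily F N ε₀ (zeta316OfRecord F N (numerics7OfFamily ε₀) 1 1) (RzOfRecord F N) (ZtOfRecord F N)).HasResidualsOfRecord F N :=
  ⟨rfl, rfl, rfl⟩

/-- **… hence `ZtUnity` holds at it** (row Z; K0b by name). [cite: Balaban1988Convergent, (3.16)–(3.20) pp.268–269] -/
theorem ztUnity_theta13LiveOfFamily :
    (theta13LiveOfFamily F N ε₀ (zeta316OfRecord F N (numerics7OfFamily ε₀) 1 1) (RzOfRecord F N) (ZtOfRecord F N)).ZtUnity F N :=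
  (hasResidualsOfRecord_theta13LiveOfFamily F N ε₀).ztUnity

/-- **★ ROW P12 AT `θ₁₃` from `Provisos₁₃` there ALONE.** [cite: Balaban1988Convergent, (3.22) p.269, (3.24) p.270; Balaban1989LargeFieldI, (0.3)–(0.4) p.176] -/
theorem slotsNondegenerate₁₃_theta13LiveOfFamily (h : (theta13LiveOfFamily F N ε₀ ζ Rz Zt).Provisos₁₃ F N) :
    (theta13LiveOfFamily F N ε₀ ζ Rz Zt).SlotsNondegenerate₁₃ F N :=
  Stage13Params.slotsNondegenerate₁₃_liveRepin F N (theta13OfFamily F N ε₀ ζ Rz Zt) h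

/-- **★★ THE K0″ BODY FOR `F` AT `N = 2` FROM THE STAGE-13 WITNESS ⟸ `0 < ε₀` and `Provisos₁₃` AT IT, ALONE** (READY-13's K0″ text: `Provisos₁₃ ∧ (ZtUnity ∧
SlotsNondegenerate₁₃) ∧ Admissible`).  NOT a discharge: `h` is the displayed provisos at the witness. [cite: Balaban1988Convergent, Thm 1 p.262, (3.16)–(3.22) pp.268–269; Balaban1989LargeFieldI, (0.3)–(0.4) p.176 (bookkeeping)] -/
theorem exists_k0_of_theta13LiveOfFamily_of_provisos₁₃ (F : T4Family) {ε₀ : ℝ} (hε : 0 < ε₀)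
    (h : (theta13LiveOfFamily F 2 ε₀ (zeta316OfRecord F 2 (numerics7OfFamily ε₀) 1 1) (RzOfRecord F 2) (ZtOfRecord F 2)).Provisos₁₃ F 2) :
    ∃ θ : Stage13Params F 2, θ.Provisos₁₃ F 2 ∧ (θ.ZtUnity F 2 ∧ θ.SlotsNondegenerate₁₃ F 2) ∧ θ.Admissible F 2 :=
  ⟨_, h, ⟨ztUnity_theta13LiveOfFamily F 2 ε₀, slotsNondegenerate₁₃_theta13LiveOfFamily F 2 ε₀ _ _ _ h⟩, admissible_theta13LiveOfFamily F 2 _ _ _ hε⟩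

end Theta13

/-! ## §3. THE WITNESS OF RECORD at the displayed pin `ε₀ := 1` (no live ε₀-consumer at Stage 13 — def-T CONSUMER-AUDIT; re-pinnable by ONE def) -/

section OfRecord13

/-- **THE DISPLAYED PIN OF THE SMALL-FIELD THRESHOLD AT STAGE 13**: `ε₀ := 1` — the Stage-12 default (`numerics7OfFamily 1 = numerics7OfRecord₁₂`, `rfl`).  No Stage-13
field, face or gate row reads an `ε₀`-smallness (def-T CONSUMER-AUDIT: the far-field guard's only reader is the dropped everywhere β-version proviso; the (2.9)
hierarchy reads `δ + 4ε₁ ≤ ε₀`, met by `ε₁ := ε₀ ∕ 8`); should a consumer bring one (row P11's [15] Thm 1; LOCATED-L if it reads `F.L`), THIS def is re-pinned and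
every face below re-keys by `rfl`.  NOT Bałaban's constant. [cite: Balaban1987RG1, (1.2) p.260 and p.259 (bookkeeping witness)] -/
def eps0OfRecord₁₃ : ℝ := 1

/-- The pin is positive. [cite: Balaban1987RG1, p.259 (bookkeeping)] -/
theorem eps0OfRecord₁₃_pos : 0 < eps0OfRecord₁₃ := one_pos

/-- At the pin the numerics of the family ARE the Stage-12 numerics of record (`rfl`). [cite: Balaban1988Convergent, (2.4) p.255 (bookkeeping)] -/
theorem numerics7OfFamily_eps0OfRecord₁₃ : numerics7OfFamily eps0OfRecord₁₃ = numerics7OfRecord₁₂ := rfl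

variable (F : T4Family) (N : ℕ) [NeZero N]

/-- **THE STAGE-13 WITNESS OF RECORD** `θ₁₃ := theta13LiveOfFamily F N eps0OfRecord₁₃` at K0b's residuals of record. [cite: Balaban1989LargeFieldI, (0.3) p.176; Balaban1988Convergent, (2.10) p.256, (3.16) p.268, (2.21) p.258, (3.20) p.269 (bookkeeping witness)] -/
def theta13LiveOfRecord : Stage13Params F N :=
  theta13LiveOfFamily F N eps0OfRecord₁₃ (zeta316OfRecord F N (numerics7OfFamily eps0OfRecord₁₃) 1 1) (RzOfRecord F N) (ZtOfRecord F N)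

/-- Unfolding (`rfl`). [cite: Balaban1989LargeFieldI, (0.3) p.176 (bookkeeping)] -/
theorem theta13LiveOfRecord_eq :
    theta13LiveOfRecord F N = theta13LiveOfFamily F N eps0OfRecord₁₃ (zeta316OfRecord F N (numerics7OfFamily eps0OfRecord₁₃) 1 1) (RzOfRecord F N) (ZtOfRecord F N) := rfl

/-- **`θ₁₃` of record is Stage-13 admissible** (row G, hypothesis-free). [cite: Balaban1987RG1, (0.21) p.256, (2.9) p.266; Balaban1988Convergent, (2.10) p.256 (bookkeeping witness)] -/
theorem admissible_theta13LiveOfRecord : (theta13LiveOfRecord F N).Admissible F N :=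
  admissible_theta13LiveOfFamily F N _ _ _ eps0OfRecord₁₃_pos

/-- **`θ₁₃` of record carries K0b's residuals** (row Z input). [cite: Balaban1988Convergent, (3.16) p.268, (2.21) p.258, (3.20) p.269 (bookkeeping)] -/
theorem hasResidualsOfRecord_theta13LiveOfRecord : (theta13LiveOfRecord F N).HasResidualsOfRecord F N :=
  hasResidualsOfRecord_theta13LiveOfFamily F N eps0OfRecord₁₃

/-- **`ZtUnity` at `θ₁₃` of record** (row Z). [cite: Balaban1988Convergent, (3.16)–(3.20) pp.268–269] -/
theorem ztUnity_theta13LiveOfRecord : (theta13LiveOfRecord F N).ZtUnity F N :=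
  ztUnity_theta13LiveOfFamily F N eps0OfRecord₁₃

/-- **Row P12 at `θ₁₃` of record from `Provisos₁₃` there alone.** [cite: Balaban1988Convergent, (3.22) p.269, (3.24) p.270; Balaban1989LargeFieldI, (0.3)–(0.4) p.176] -/
theorem slotsNondegenerate₁₃_theta13LiveOfRecord (h : (theta13LiveOfRecord F N).Provisos₁₃ F N) : (theta13LiveOfRecord F N).SlotsNondegenerate₁₃ F N :=
  slotsNondegenerate₁₃_theta13LiveOfFamily F N eps0OfRecord₁₃ _ _ _ h

/-- **★★ THE K0″ BODY FOR `F` AT `N = 2` FROM THE WITNESS OF RECORD ⟸ `Provisos₁₃` AT IT, ALONE.** NOT a discharge. [cite: Balaban1988Convergent, Thm 1 p.262, (3.16)–(3.22) pp.268–269; Balaban1989LargeFieldI, (0.3)–(0.4) p.176 (bookkeeping)] -/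
theorem exists_k0_of_theta13LiveOfRecord_of_provisos₁₃ (F : T4Family) (h : (theta13LiveOfRecord F 2).Provisos₁₃ F 2) :
    ∃ θ : Stage13Params F 2, θ.Provisos₁₃ F 2 ∧ (θ.ZtUnity F 2 ∧ θ.SlotsNondegenerate₁₃ F 2) ∧ θ.Admissible F 2 :=
  ⟨_, h, ⟨ztUnity_theta13LiveOfRecord F 2, slotsNondegenerate₁₃_theta13LiveOfRecord F 2 h⟩, admissible_theta13LiveOfRecord F 2⟩

/-- **★ `Provisos₁₃` AT THE WITNESS OF RECORD FROM ROW P11 ALONE** (`provisos₁₃_liveRepin₁₃_of_bg` at `θ₀ᶠᵃᵐ,¹³(1)` with K0b's residuals; the `bg` hypothesis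
is the text of `Provisos₁₃.bg` at the witness, verbatim — the ranged token `BgProvisoΛ`). [cite: Balaban1988Convergent, (2.18) p.257, (2.28) p.259, (3.16) p.268, (3.22) p.269; Balaban1989LargeFieldI, (0.3)–(0.4) p.176 (bookkeeping)] -/
theorem provisos₁₃_theta13LiveOfRecord_of_bg
    (hbg : ∀ (p : B12.RunParams) (n : ℕ), n ≤ p.K → Step.InInterval (theta13LiveOfRecord F N).γ n (gOfRecord₁₃ F N (theta13LiveOfRecord F N) p) →
      BgProvisoΛ F N p.K (settingOfRecord₁₃ F N (theta13LiveOfRecord F N) p) ((theta13LiveOfRecord F N).Rz p.K) (theta13LiveOfRecord F N).τ9.M n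
        (suppOfRecord₁₃ F N (theta13LiveOfRecord F N) p n) (UbgOfRecord₁₃ F N (theta13LiveOfRecord F N) p n)) :
    (theta13LiveOfRecord F N).Provisos₁₃ F N :=
  (theta13OfFamily F N eps0OfRecord₁₃ _ _ _).provisos₁₃_liveRepin₁₃_of_bg (hasResidualsOfRecord_theta13OfFamily F N eps0OfRecord₁₃) hbg

/-- **★★★ THE K0″ BODY FOR `F` AT `N = 2` FROM EXACTLY ONE ROW READ AT THE WITNESS OF RECORD — ROW P11 `bg`** (seat node00-def-P11: [III] (2.7) + [15] Thm 1 for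
def-R's `UbgMSOfRecord` on the regular support, on the RANGED token `BgProvisoΛ`).  Every other field, letter and conjunct of the successor text of
`Record12Inhabited` is a theorem at `theta13LiveOfRecord` ((H-U) by K0c's `localBgMeasurable`).  A REDUCTION — NOT a discharge; nothing of Bałaban is asserted.
[cite: Balaban1988Convergent, Thm 1 p.262, (2.7) p.255, (2.28) p.259, (3.16)–(3.22) pp.268–269; Balaban1989LargeFieldI, (0.3)–(0.4) p.176 (bookkeeping)] -/
theorem exists_k0_of_bg_theta13LiveOfRecord (F : T4Family)
    (hbg : ∀ (p : B12.RunParams) (n : ℕ), n ≤ p.K → Step.InInterval (theta13LiveOfRecord F 2).γ n (gOfRecord₁₃ F 2 (theta13LiveOfRecord F 2) p) →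
      BgProvisoΛ F 2 p.K (settingOfRecord₁₃ F 2 (theta13LiveOfRecord F 2) p) ((theta13LiveOfRecord F 2).Rz p.K) (theta13LiveOfRecord F 2).τ9.M n
        (suppOfRecord₁₃ F 2 (theta13LiveOfRecord F 2) p n) (UbgOfRecord₁₃ F 2 (theta13LiveOfRecord F 2) p n)) :
    ∃ θ : Stage13Params F 2, θ.Provisos₁₃ F 2 ∧ (θ.ZtUnity F 2 ∧ θ.SlotsNondegenerate₁₃ F 2) ∧ θ.Admissible F 2 :=
  exists_k0_of_theta13LiveOfRecord_of_provisos₁₃ F (provisos₁₃_theta13LiveOfRecord_of_bg F 2 hbg)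

end OfRecord13

end Literature.MathematicalPhysics.QuantumFieldTheory.Balaban1983to89.Node00

end
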